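/-
Copyright (c) 2026 the pub-hodgecm-mathlib formalisation cell (harness21).  Prover seat hodgecm-mathlib-F0P2-p11 (g0) (L1 re-deal s1969∕s1970, LEAD F0P6-plan (g14)
EMIT #1 «p22» (R1-α)), Track B «K2-LIT» ∕ hLiu418 #184♮, ROAD Φ, G5-b = Φ7-3, organ (R1-α)(a), device «the big cell moved to the corner frame»
(sequel of ★ p861365 `K2LiuRankOneBigCellUnfold`, ★ p861293 `K2LiuRankOneCornerOrbit`, ★ p861210 `K2LiuRankOneOrbitTransport`).  THEOREMS ONLY.
-/
import Summits.HodgeConjecture.HodgeConjecture.Theorems.K2LiuRankOneBigCellUnfold      -- ★ p861365 (a): `exists_corner_disintegration`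
import Summits.HodgeConjecture.HodgeConjecture.Theorems.K2LiuRankOneCornerOrbit        -- ★ p861293 (b3-ii)(A): `corner_levi_iff_mk_eq` (+ ★ p861210, ★ α3-1, ★ α2c)
import Summits.HodgeConjecture.HodgeConjecture.Theorems.K2LiuSiegelWeylCharacterLaw     -- ★ `isSiegelDelta_weylDelta_conj_levi` (`w_Δ Λg w_Δ ∈ P_Δ`)
import Summits.HodgeConjecture.HodgeConjecture.Theorems.K2LiuWeylDeltaRational          -- ★ `weylDelta_mem_ratH`
import Summits.HodgeConjecture.HodgeConjecture.Theorems.K2LiuSiegelCharacterTrivialOnRational  -- ★ #10a `siegelDeltaCharacter_eq_one_of_mem_ratH`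
import HarnessLib

/-!
# Crux `HLiu418`, ROAD Φ, organ Φ7-3 (R1-α)(a), THE HEAD: THE BIG CELL `W_S(f)(h)` OF A RANK-ONE COEFFICIENT IN THE CORNER FRAME —
# `W_S(f)(h) = ∫ conj ψ_S(Λĝ⁻¹ v Λĝ) · f(w_Δ v (Λĝ h)) dνN(v) = c • ∫_{𝔸_{L⁺}} conj ψ_S(Λĝ⁻¹ n₂(t) Λĝ) · (∫_{N_χ(𝔸)} f(w_Δ z (n₂ t · Λĝ h)) dμZ) dμ(t)`, `ĝ = γ[w]`

Cell `hodgecm-mathlib`, crux item hLiu418 = `stmt-HodgeConjecture-24832` (helper lane, count-neutral); squad K2 ∕ K2Liu, LEAD F0P6-plan (g14), desk (R1-α)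
K2E5-p17 (g8); prover F0P2-p11 (g0).  THEOREMS ONLY (no `def`, no `instance`, no notation, no named-fact hypothesis, no `sorry`).

WHY.  ★ p861365 `exists_whittakerDelta_eq_corner_integral` unfolds the big cell `W_S(f)(h) = ∫_{N_Δ(𝔸)} conj ψ_S(u) f(w_Δ u h) dνN` along the corner line ONLY for an index whose
character is already trivial on `N_χ(𝔸)`.  A rank-one `T_L`-skew `S = u ⊗ w` is brought to that position by the rational Levi element `Λĝ`, `ĝ = (γ[w]) ⊗ 1` (★ p861293
`corner_levi_iff_mk_eq`): the change of variables `u = Λĝ⁻¹ v Λĝ` (measure-preserving BY VALUE, as ★ α3-2's `hconj`) turns `ψ_S(u)` into the transported twist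
`ψ_S(Λĝ⁻¹ v Λĝ)` — left-`N_χ(𝔸)`-invariant by ★ p861210 `conj_unipDeltaChar_conj_invariant` — and `f(w_Δ Λĝ⁻¹ v Λĝ h) = f(w_Δ v (Λĝ h))` because `w_Δ Λĝ⁻¹ w_Δ` is a
RATIONAL Siegel element (★ `isSiegelDelta_weylDelta_conj_levi`, ★ `weylDelta_mem_ratH`, ★ #10a `siegelDeltaCharacter_eq_one_of_mem_ratH`).
* §1 (any `n`) **`whittakerDelta_eq_integral_levi_conj`** — for a Siegel section `f`, `g ∈ GL_n(L)` and `h`: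
  `W_S(f)(h) = ∫ conj ψ_S(Λĝ⁻¹ v Λĝ) · f(w_Δ v (Λĝ h)) dνN(v)` (no convergence hypothesis: a measure-preserving change of variables).
* §2 (`n = 2`) **`exists_whittakerDelta_rankOne_eq_corner_integral`** — THE (R1-α)(a) HEAD: with `n₂`, `Z = N_χ(𝔸)`, `μZ`, `c` of ★ p861365 `exists_corner_disintegration`,
  for every rank-one `T_L`-skew `S = u ⊗ w`, row section `γ`, continuous Siegel section `f` with `v ↦ f(w_Δ v (Λĝ h))` `νN`-integrable (`ĝ = (γ[w]) ⊗ 1`):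
  `W_S(f)(h) = c • ∫ conj ψ_S(Λĝ⁻¹ · n₂ t · Λĝ) · (∫_Z f(w_Δ · z · (n₂ t · (Λĝ h))) dμZ(z)) dμ(t)` — the companion of ★ p861327 (the middle term) over the SAME corner line.
References: [MoeglinWaldspurger1995] II.1.7; [KudlaRallis1994] §2 (2.10)–(2.12); [Shimura1997] §18.4–18.5; [Tan1999] §4; [GelbartPiatetskishapiroRallis1987] Part A §§1–2.
HONEST LABEL.  Count-neutral helper: `HC_CM` is proved only modulo the 7 printed citations (2 remaining named inputs: hLiu418 = `stmt-HodgeConjecture-24832`,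
h413 = `stmt-HodgeConjecture-24833`) until rung 0 closes.
-/

set_option autoImplicit false
set_option linter.dupNamespace false -- the mandated namespace repeats `HodgeConjecture.HodgeConjecture`

noncomputable section

open scoped Matrix ENNReal NNReal ComplexConjugate
open NumberField IsDedekindDomain MeasureTheory MeasureTheory.Measure Filter Set Function
open Literature.NumberTheory.Automorphic Literature.NumberTheory.Automorphic.UnitaryGroup Literature.NumberTheory.GaloisRepresentations
open Literature.NumberTheory.GelbartRogawski1991 Literature.NumberTheory.GelbartRogawski1991.GRConstruction
open Literature.NumberTheory.GelbartRogawski1991.AdaptedBlocks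
open Literature.NumberTheory.K2Lit.SiegelDoubled Literature.MeasureTheory.Group
open UnitaryDualPair

namespace Summit.HodgeConjecture.HodgeConjecture.Cruxes.HLiu418.K2LiuRankOneBigCellCornerFrame

open K2LiuUnipotentCoveringWeight K2LiuSiegelUnipotentFourierDefs K2LiuSiegelUnipotentCharacters K2LiuSiegelLeviConjUnipDeltaChar K2LiuSiegelRationalLeviDecomposition
  K2LiuSiegelMiddleCellLeviCriterion K2LiuConstantTermMiddleCellPrelims K2LiuSiegelWeylCharacterLaw K2LiuWeylDeltaRational K2LiuSiegelCharacterTrivialOnRational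
  K2LiuRankOneOrbitTransport K2LiuRankOneCornerOrbit K2LiuRankOneBigCellUnfold

variable {L : Type} [Field L] [NumberField L] [IsCMField L]

/-! ## §1 The big cell after the Levi change of variables `u = Λĝ⁻¹ v Λĝ` (any `n`) -/

section AnyRank

variable {N M n : ℕ} {e : Fin N × Fin M ≃ Fin n}
  {dV : Fin N → L} {hdV : ∀ i, IsCMField.complexConj L (dV i) = dV i}
  {dW : Fin M → L} {hdW : ∀ i, IsCMField.complexConj L (dW i) = dW i}
variable [MeasurableSpace (unipDelta L e dV hdV dW hdW)] [BorelSpace (unipDelta L e dV hdV dW hdW)]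
  (Λ : GL (Fin n) (AdeleRing (𝓞 L) L) →* HA L e dV hdV dW hdW)
  (hΛ : ∀ g : GL (Fin n) (AdeleRing (𝓞 L) L), blk L e dV hdV dW hdW (Λ g) =
    cayR (AdeleRing (𝓞 L) L) (Fin n) * Matrix.fromBlocks (g : Matrix (Fin n) (Fin n) (AdeleRing (𝓞 L) L)) 0 0
      (((gramR L e dV hdV dW hdW).map ((algebraMap L (AdeleRing (𝓞 L) L)).comp (algebraMap (Fp L) L)))⁻¹ *
        (((g⁻¹ : GL (Fin n) (AdeleRing (𝓞 L) L)) : Matrix (Fin n) (Fin n) (AdeleRing (𝓞 L) L)).map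
          (conjAdele (Fp L) L (IsCMField.complexConj L)))ᵀ *
        (gramR L e dV hdV dW hdW).map ((algebraMap L (AdeleRing (𝓞 L) L)).comp (algebraMap (Fp L) L))) *
      cayRinv (AdeleRing (𝓞 L) L) (Fin n))

include hΛ in
/-- **THE BIG CELL AFTER THE LEVI CHANGE OF VARIABLES.**  For a Siegel section `f` of `I_Δ(s, χ)`, `g ∈ GL_n(L)` with `u ↦ Λĝ u Λĝ⁻¹` preserving `νN` (BY VALUE), any index `S`
and `h ∈ H(𝔸)`:  `W_S(f)(h) = ∫ conj ψ_S(Λĝ⁻¹ v Λĝ) · f(w_Δ v (Λĝ h)) dνN(v)`  (`u = Λĝ⁻¹ v Λĝ`; `w_Δ Λĝ⁻¹ w_Δ ∈ P_Δ(L⁺)` has trivial inducing character).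
[cite: MoeglinWaldspurger1995, II.1.7] [cite: KudlaRallis1994, §2] -/
theorem whittakerDelta_eq_integral_levi_conj (hdV0 : ∀ i, dV i ≠ 0) (hdW0 : ∀ i, dW i ≠ 0) (νN : Measure (unipDelta L e dV hdV dW hdW)) [νN.IsMulLeftInvariant]
    {χ : HeckeCharacter L} {s : ℂ} {f : HA L e dV hdV dW hdW → ℂ} (hf : IsSiegelDeltaSection L e dV hdV dW hdW χ s f) (g : GL (Fin n) L)
    (hconj : MeasurePreserving (fun u : unipDelta L e dV hdV dW hdW =>
      (⟨Λ (Matrix.GeneralLinearGroup.map (algebraMap L (AdeleRing (𝓞 L) L)) g) * (u : HA L e dV hdV dW hdW) *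
          (Λ (Matrix.GeneralLinearGroup.map (algebraMap L (AdeleRing (𝓞 L) L)) g))⁻¹,
        conj_levi_mem_unipDelta L e dV hdV dW hdW Λ hΛ _ u.2⟩ : unipDelta L e dV hdV dW hdW)) νN νN)
    (S : Matrix (Fin n) (Fin n) L) (h : HA L e dV hdV dW hdW) :
    whittakerDelta L e dV hdV dW hdW νN S f h =
      ∫ v, conj (unipDeltaChar L e dV hdV dW hdW S ((Λ (Matrix.GeneralLinearGroup.map (algebraMap L (AdeleRing (𝓞 L) L)) g))⁻¹ * (v : HA L e dV hdV dW hdW) *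
          Λ (Matrix.GeneralLinearGroup.map (algebraMap L (AdeleRing (𝓞 L) L)) g)) : ℂ) *
        f (weylDelta L e dV hdV dW hdW * (v : HA L e dV hdV dW hdW) * (Λ (Matrix.GeneralLinearGroup.map (algebraMap L (AdeleRing (𝓞 L) L)) g) * h)) ∂νN := by
  set p : HA L e dV hdV dW hdW := Λ (Matrix.GeneralLinearGroup.map (algebraMap L (AdeleRing (𝓞 L) L)) g) with hp
  -- the conjugation as a measurable equivalence, measure-preserving in both directions
  obtain ⟨φ, hφ, hφs⟩ := exists_conj_mulEquiv p (fun u hu => conj_levi_mem_unipDelta L e dV hdV dW hdW Λ hΛ _ hu)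
    (fun u hu => inv_conj_levi_mem_unipDelta L e dV hdV dW hdW Λ hΛ _ hu)
  have hφfun : (φ : unipDelta L e dV hdV dW hdW → unipDelta L e dV hdV dW hdW) = fun u : unipDelta L e dV hdV dW hdW =>
      (⟨p * (u : HA L e dV hdV dW hdW) * p⁻¹, conj_levi_mem_unipDelta L e dV hdV dW hdW Λ hΛ _ u.2⟩ : unipDelta L e dV hdV dW hdW) :=
    funext fun u => Subtype.ext (hφ u)
  have hφsfun : (φ.symm : unipDelta L e dV hdV dW hdW → unipDelta L e dV hdV dW hdW) = fun u : unipDelta L e dV hdV dW hdW =>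
      (⟨p⁻¹ * (u : HA L e dV hdV dW hdW) * p, inv_conj_levi_mem_unipDelta L e dV hdV dW hdW Λ hΛ _ u.2⟩ : unipDelta L e dV hdV dW hdW) :=
    funext fun u => Subtype.ext (hφs u)
  have hφm : Measurable (φ : unipDelta L e dV hdV dW hdW → unipDelta L e dV hdV dW hdW) := by
    rw [hφfun]; exact (Continuous.subtype_mk ((continuous_const.mul continuous_subtype_val).mul continuous_const) _).measurable
  have hφsm : Measurable (φ.symm : unipDelta L e dV hdV dW hdW → unipDelta L e dV hdV dW hdW) := by
    rw [hφsfun]; exact (Continuous.subtype_mk ((continuous_const.mul continuous_subtype_val).mul continuous_const) _).measurable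
  set eφ : unipDelta L e dV hdV dW hdW ≃ᵐ unipDelta L e dV hdV dW hdW :=
    { toEquiv := φ.toEquiv, measurable_toFun := hφm, measurable_invFun := hφsm } with heφ
  have hmp : MeasurePreserving eφ νN νN := by
    have h1 : (eφ : unipDelta L e dV hdV dW hdW → unipDelta L e dV hdV dW hdW) = φ := rfl
    rw [show (eφ : unipDelta L e dV hdV dW hdW → unipDelta L e dV hdV dW hdW) =
      fun u : unipDelta L e dV hdV dW hdW => (⟨p * (u : HA L e dV hdV dW hdW) * p⁻¹, conj_levi_mem_unipDelta L e dV hdV dW hdW Λ hΛ _ u.2⟩ : unipDelta L e dV hdV dW hdW)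
      from h1.trans hφfun]
    exact hconj
  have hmps : MeasurePreserving eφ.symm νN νN := hmp.symm eφ
  have heφs : ∀ v : unipDelta L e dV hdV dW hdW, ((eφ.symm v : unipDelta L e dV hdV dW hdW) : HA L e dV hdV dW hdW) = p⁻¹ * (v : HA L e dV hdV dW hdW) * p :=
    fun v => hφs v
  -- `w_Δ p⁻¹ w_Δ` is a rational Siegel element with trivial inducing character
  have hq : IsSiegelDelta L e dV hdV dW hdW (weylDelta L e dV hdV dW hdW * p⁻¹ * weylDelta L e dV hdV dW hdW) := by
    rw [hp, ← map_inv, ← map_inv]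
    exact isSiegelDelta_weylDelta_conj_levi L e dV hdV dW hdW Λ hΛ _
  have hqrat : weylDelta L e dV hdV dW hdW * p⁻¹ * weylDelta L e dV hdV dW hdW ∈ ratH L e dV hdV dW hdW := by
    refine mul_mem (mul_mem (weylDelta_mem_ratH L e dV hdV dW hdW) (inv_mem ?_)) (weylDelta_mem_ratH L e dV hdV dW hdW)
    exact levi_map_mem_ratH L e dV hdV dW hdW Λ hΛ hdV0 hdW0 g
  have hσ := siegelDeltaCharacter_eq_one_of_mem_ratH χ s hqrat
  -- change of variables
  rw [whittakerDelta_def, ← hmps.integral_comp eφ.symm.measurableEmbedding]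
  refine integral_congr_ae (ae_of_all _ fun v => ?_)
  have harg : weylDelta L e dV hdV dW hdW * (p⁻¹ * (v : HA L e dV hdV dW hdW) * p) * h =
      (weylDelta L e dV hdV dW hdW * p⁻¹ * weylDelta L e dV hdV dW hdW) * (weylDelta L e dV hdV dW hdW * (v : HA L e dV hdV dW hdW) * (p * h)) := by
    rw [show (weylDelta L e dV hdV dW hdW * p⁻¹ * weylDelta L e dV hdV dW hdW) * (weylDelta L e dV hdV dW hdW * (v : HA L e dV hdV dW hdW) * (p * h)) =
        weylDelta L e dV hdV dW hdW * p⁻¹ * ((weylDelta L e dV hdV dW hdW * weylDelta L e dV hdV dW hdW) * ((v : HA L e dV hdV dW hdW) * (p * h))) by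
          simp only [mul_assoc], weylDelta_mul_weylDelta, one_mul]
    simp only [mul_assoc]
  show conj (unipDeltaChar L e dV hdV dW hdW S ((eφ.symm v : unipDelta L e dV hdV dW hdW) : HA L e dV hdV dW hdW) : ℂ) *
      f (weylDelta L e dV hdV dW hdW * ((eφ.symm v : unipDelta L e dV hdV dW hdW) : HA L e dV hdV dW hdW) * h) =
    conj (unipDeltaChar L e dV hdV dW hdW S (p⁻¹ * (v : HA L e dV hdV dW hdW) * p) : ℂ) * f (weylDelta L e dV hdV dW hdW * (v : HA L e dV hdV dW hdW) * (p * h))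
  rw [heφs, harg, hf _ hq, hσ, one_mul]

end AnyRank

/-! ## §2 `n = 2`: the big cell of a rank-one coefficient along the corner line -/

section Two

variable {N M : ℕ} {e : Fin N × Fin M ≃ Fin 2}
  {dV : Fin N → L} {hdV : ∀ i, IsCMField.complexConj L (dV i) = dV i}
  {dW : Fin M → L} {hdW : ∀ i, IsCMField.complexConj L (dW i) = dW i}
variable [MeasurableSpace (unipDelta L e dV hdV dW hdW)] [BorelSpace (unipDelta L e dV hdV dW hdW)]

variable {g₀ : UnitaryGroup.rationalPair (Fp L) L (IsCMField.complexConj L) N M (Matrix.diagonal dV) (Matrix.diagonal dW)}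
  (hg₀ : ((g₀ : GL (Fin N × Fin M) L) : Matrix (Fin N × Fin M) (Fin N × Fin M) L) = Matrix.diagonal (fun k => 1 - 2 * (![0, 1] : Fin 2 → L) (e k)))
  (Λ : GL (Fin 2) (AdeleRing (𝓞 L) L) →* HA L e dV hdV dW hdW)
  (hΛ : ∀ g : GL (Fin 2) (AdeleRing (𝓞 L) L), blk L e dV hdV dW hdW (Λ g) =
    cayR (AdeleRing (𝓞 L) L) (Fin 2) * Matrix.fromBlocks (g : Matrix (Fin 2) (Fin 2) (AdeleRing (𝓞 L) L)) 0 0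
      (((gramR L e dV hdV dW hdW).map ((algebraMap L (AdeleRing (𝓞 L) L)).comp (algebraMap (Fp L) L)))⁻¹ *
        (((g⁻¹ : GL (Fin 2) (AdeleRing (𝓞 L) L)) : Matrix (Fin 2) (Fin 2) (AdeleRing (𝓞 L) L)).map
          (conjAdele (Fp L) L (IsCMField.complexConj L)))ᵀ *
        (gramR L e dV hdV dW hdW).map ((algebraMap L (AdeleRing (𝓞 L) L)).comp (algebraMap (Fp L) L))) *
      cayRinv (AdeleRing (𝓞 L) L) (Fin 2))

include hg₀ hΛ in
/-- **(R1-α)(a): THE BIG CELL OF A RANK-ONE FOURIER COEFFICIENT IS ONE CORNER-LINE INTEGRAL OF THE `N_χ(𝔸)`-PERIOD OF `f(w_Δ ·)`.**  With `n₂`, `Z = N_χ(𝔸)`, `μZ`, `c` of ★ p861365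
`exists_corner_disintegration`: for every `g`-indexed Levi conjugation preserving `νN` (BY VALUE), every rank-one `T_L`-skew `S = u ⊗ w` (`u, w ≠ 0`), every row section `γ`,
every continuous Siegel section `f` of `I_Δ(s, χ)` and every `h` with `v ↦ f(w_Δ v (Λĝ h))` `νN`-integrable (`ĝ = (γ [w]) ⊗ 1`):
  `W_S(f)(h) = c • ∫ conj ψ_S(Λĝ⁻¹ · n₂ t · Λĝ) · (∫_Z f(w_Δ · z · (n₂ t · (Λĝ h))) dμZ(z)) dμ(t)`.
[cite: MoeglinWaldspurger1995, II.1.7] [cite: KudlaRallis1994, §2 (2.10)–(2.12)] [cite: Shimura1997, §18.4] [cite: Tan1999, §4] -/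
theorem exists_whittakerDelta_rankOne_eq_corner_integral (hdV0 : ∀ i, dV i ≠ 0) (hdW0 : ∀ i, dW i ≠ 0)
    (νN : Measure (unipDelta L e dV hdV dW hdW)) [IsHaarMeasure νN]
    [MeasurableSpace (AdeleRing (𝓞 (Fp L)) (Fp L))] [BorelSpace (AdeleRing (𝓞 (Fp L)) (Fp L))]
    (μ : Measure (AdeleRing (𝓞 (Fp L)) (Fp L))) [μ.IsAddHaarMeasure] :
    ∃ (n₂ : AdeleRing (𝓞 (Fp L)) (Fp L) → HA L e dV hdV dW hdW) (Z : Subgroup (unipDelta L e dV hdV dW hdW)) (μZ : Measure Z) (c : ℝ≥0∞),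
      Continuous n₂ ∧ (∀ s t, n₂ (s + t) = n₂ s * n₂ t) ∧ (∀ t, n₂ t ∈ unipDelta L e dV hdV dW hdW) ∧
      (∀ t, (blk L e dV hdV dW hdW (n₂ t)).toBlocks₁₂ =
        Matrix.single (1 : Fin 2) (1 : Fin 2) (AdeleRing.baseChange (Fp L) L t * algebraMap L (AdeleRing (𝓞 L) L) (imagUnit L))) ∧
      (∀ t : Fp L, n₂ (algebraMap (Fp L) (AdeleRing (𝓞 (Fp L)) (Fp L)) t) ∈ ratH L e dV hdV dW hdW) ∧
      (∀ u : unipDelta L e dV hdV dW hdW, u ∈ Z ↔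
        IsSiegelDelta L e dV hdV dW hdW (iotaGG L e dV hdV dW hdW (1, UnitaryGroup.rationalPairToAdelic (Fp L) L (IsCMField.complexConj L) N M (Matrix.diagonal dV) (Matrix.diagonal dW) g₀) * (u : HA L e dV hdV dW hdW) * (iotaGG L e dV hdV dW hdW (1, UnitaryGroup.rationalPairToAdelic (Fp L) L (IsCMField.complexConj L) N M (Matrix.diagonal dV) (Matrix.diagonal dW) g₀))⁻¹)) ∧
      IsHaarMeasure μZ ∧ c ≠ 0 ∧ c ≠ ∞ ∧
      ∀ {χ : HeckeCharacter L} {s : ℂ} {f : HA L e dV hdV dW hdW → ℂ} (_ : IsSiegelDeltaSection L e dV hdV dW hdW χ s f) (_ : Continuous f)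
        {S : Matrix (Fin 2) (Fin 2) L}
        (_ : S ∈ skewMatrices ((IsCMField.complexConj L : L ≃ₐ[Fp L] L) : L →+* L) ((gramR L e dV hdV dW hdW).map (algebraMap (Fp L) L)))
        {u w : Fin 2 → L} (_ : S = Matrix.vecMulVec u w) (_ : u ≠ 0) (hw : w ≠ 0)
        (γ : Projectivization L (Fin 2 → L) → GL (Fin 2) L)
        (_ : ∀ p, Projectivization.mk L ((γ p : Matrix (Fin 2) (Fin 2) L) 1) (row_ne_zero (γ p) 1) = p)
        (_ : MeasurePreserving (fun v : unipDelta L e dV hdV dW hdW =>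
          (⟨Λ (Matrix.GeneralLinearGroup.map (algebraMap L (AdeleRing (𝓞 L) L)) (γ (Projectivization.mk L w hw))) * (v : HA L e dV hdV dW hdW) *
              (Λ (Matrix.GeneralLinearGroup.map (algebraMap L (AdeleRing (𝓞 L) L)) (γ (Projectivization.mk L w hw))))⁻¹,
            conj_levi_mem_unipDelta L e dV hdV dW hdW Λ hΛ _ v.2⟩ : unipDelta L e dV hdV dW hdW)) νN νN)
        (h : HA L e dV hdV dW hdW)
        (_ : Integrable (fun v : unipDelta L e dV hdV dW hdW => f (weylDelta L e dV hdV dW hdW * (v : HA L e dV hdV dW hdW) *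
          (Λ (Matrix.GeneralLinearGroup.map (algebraMap L (AdeleRing (𝓞 L) L)) (γ (Projectivization.mk L w hw))) * h))) νN),
        whittakerDelta L e dV hdV dW hdW νN S f h =
          c.toReal • ∫ t, conj (unipDeltaChar L e dV hdV dW hdW S
              ((Λ (Matrix.GeneralLinearGroup.map (algebraMap L (AdeleRing (𝓞 L) L)) (γ (Projectivization.mk L w hw))))⁻¹ * n₂ t *
                Λ (Matrix.GeneralLinearGroup.map (algebraMap L (AdeleRing (𝓞 L) L)) (γ (Projectivization.mk L w hw)))) : ℂ) *
            (∫ z, f (weylDelta L e dV hdV dW hdW * ((z : unipDelta L e dV hdV dW hdW) : HA L e dV hdV dW hdW) *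
              (n₂ t * (Λ (Matrix.GeneralLinearGroup.map (algebraMap L (AdeleRing (𝓞 L) L)) (γ (Projectivization.mk L w hw))) * h))) ∂μZ) ∂μ := by
  obtain ⟨n₂, Z, μZ, c, hn₂c, hn₂add, hn₂mem, hn₂X, hn₂rat, hZlaw, hμZ, hc0, hctop, -, hboch⟩ :=
    exists_corner_disintegration L e dV hdV dW hdW hdV0 hdW0 hg₀ Λ hΛ νN μ
  refine ⟨n₂, Z, μZ, c, hn₂c, hn₂add, hn₂mem, hn₂X, hn₂rat, hZlaw, hμZ, hc0, hctop, ?_⟩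
  intro χ s f hf hfc S hS u w hS1 hu hw γ hγ hconj h hint
  -- the Levi frame `Λĝ`, `ĝ = (γ[w]) ⊗ 1`: rational, Siegel, and (★ p861293) a corner frame of `S`
  have hpP : IsSiegelDelta L e dV hdV dW hdW (Λ (Matrix.GeneralLinearGroup.map (algebraMap L (AdeleRing (𝓞 L) L)) (γ (Projectivization.mk L w hw)))) := isSiegelDelta_levi_apply L e dV hdV dW hdW Λ hΛ _
  have hcorner := (corner_levi_iff_mk_eq L e dV hdV dW hdW Λ hΛ hdV0 hdW0 hS hS1 hu hw (γ (Projectivization.mk L w hw))).2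
    (hγ (Projectivization.mk L w hw)).symm
  -- §1: the big cell after the change of variables
  rw [whittakerDelta_eq_integral_levi_conj Λ hΛ hdV0 hdW0 νN hf (γ (Projectivization.mk L w hw)) hconj S h]
  -- the transported integrand is integrable (the twist is unimodular)
  have hψm : AEStronglyMeasurable (fun v : unipDelta L e dV hdV dW hdW =>
      conj (unipDeltaChar L e dV hdV dW hdW S ((Λ (Matrix.GeneralLinearGroup.map (algebraMap L (AdeleRing (𝓞 L) L)) (γ (Projectivization.mk L w hw))))⁻¹ * (v : HA L e dV hdV dW hdW) * (Λ (Matrix.GeneralLinearGroup.map (algebraMap L (AdeleRing (𝓞 L) L)) (γ (Projectivization.mk L w hw))))) : ℂ)) νN :=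
    ((Complex.continuous_conj.comp (continuous_unipDeltaChar L e dV hdV dW hdW S)).comp
      ((continuous_const.mul continuous_subtype_val).mul continuous_const)).aestronglyMeasurable
  have hbound : ∀ v : unipDelta L e dV hdV dW hdW, ‖conj (unipDeltaChar L e dV hdV dW hdW S ((Λ (Matrix.GeneralLinearGroup.map (algebraMap L (AdeleRing (𝓞 L) L)) (γ (Projectivization.mk L w hw))))⁻¹ * (v : HA L e dV hdV dW hdW) * (Λ (Matrix.GeneralLinearGroup.map (algebraMap L (AdeleRing (𝓞 L) L)) (γ (Projectivization.mk L w hw))))) : ℂ)‖ ≤ 1 := fun v =>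
    le_of_eq (by rw [Complex.norm_conj, norm_coe_unipDeltaChar])
  have hint' : Integrable (fun v : unipDelta L e dV hdV dW hdW => conj (unipDeltaChar L e dV hdV dW hdW S ((Λ (Matrix.GeneralLinearGroup.map (algebraMap L (AdeleRing (𝓞 L) L)) (γ (Projectivization.mk L w hw))))⁻¹ * (v : HA L e dV hdV dW hdW) * (Λ (Matrix.GeneralLinearGroup.map (algebraMap L (AdeleRing (𝓞 L) L)) (γ (Projectivization.mk L w hw))))) : ℂ) *
      f (weylDelta L e dV hdV dW hdW * (v : HA L e dV hdV dW hdW) * ((Λ (Matrix.GeneralLinearGroup.map (algebraMap L (AdeleRing (𝓞 L) L)) (γ (Projectivization.mk L w hw)))) * h))) νN :=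
    hint.bdd_mul hψm (Filter.Eventually.of_forall hbound)
  obtain ⟨-, heq⟩ := hboch (fun x : HA L e dV hdV dW hdW => conj (unipDeltaChar L e dV hdV dW hdW S ((Λ (Matrix.GeneralLinearGroup.map (algebraMap L (AdeleRing (𝓞 L) L)) (γ (Projectivization.mk L w hw))))⁻¹ * x * (Λ (Matrix.GeneralLinearGroup.map (algebraMap L (AdeleRing (𝓞 L) L)) (γ (Projectivization.mk L w hw))))) : ℂ) *
    f (weylDelta L e dV hdV dW hdW * x * ((Λ (Matrix.GeneralLinearGroup.map (algebraMap L (AdeleRing (𝓞 L) L)) (γ (Projectivization.mk L w hw)))) * h))) hint'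
  rw [heq]
  congr 1
  refine integral_congr_ae (ae_of_all _ fun t => ?_)
  show (∫ z, conj (unipDeltaChar L e dV hdV dW hdW S ((Λ (Matrix.GeneralLinearGroup.map (algebraMap L (AdeleRing (𝓞 L) L)) (γ (Projectivization.mk L w hw))))⁻¹ * (n₂ t * ((z : unipDelta L e dV hdV dW hdW) : HA L e dV hdV dW hdW)) * (Λ (Matrix.GeneralLinearGroup.map (algebraMap L (AdeleRing (𝓞 L) L)) (γ (Projectivization.mk L w hw))))) : ℂ) *
      f (weylDelta L e dV hdV dW hdW * (n₂ t * ((z : unipDelta L e dV hdV dW hdW) : HA L e dV hdV dW hdW)) * ((Λ (Matrix.GeneralLinearGroup.map (algebraMap L (AdeleRing (𝓞 L) L)) (γ (Projectivization.mk L w hw)))) * h)) ∂μZ) =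
    conj (unipDeltaChar L e dV hdV dW hdW S ((Λ (Matrix.GeneralLinearGroup.map (algebraMap L (AdeleRing (𝓞 L) L)) (γ (Projectivization.mk L w hw))))⁻¹ * n₂ t * (Λ (Matrix.GeneralLinearGroup.map (algebraMap L (AdeleRing (𝓞 L) L)) (γ (Projectivization.mk L w hw))))) : ℂ) *
      ∫ z, f (weylDelta L e dV hdV dW hdW * ((z : unipDelta L e dV hdV dW hdW) : HA L e dV hdV dW hdW) * (n₂ t * ((Λ (Matrix.GeneralLinearGroup.map (algebraMap L (AdeleRing (𝓞 L) L)) (γ (Projectivization.mk L w hw)))) * h))) ∂μZ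
  rw [← integral_const_mul]
  refine integral_congr_ae (ae_of_all _ fun z => ?_)
  have hz : ((z : unipDelta L e dV hdV dW hdW) : HA L e dV hdV dW hdW) ∈ unipDelta L e dV hdV dW hdW := (z : unipDelta L e dV hdV dW hdW).2
  -- the transported twist does not see `z ∈ N_χ(𝔸)` (★ p861210), and `n₂ t · z = z · n₂ t`
  have hψz : conj (unipDeltaChar L e dV hdV dW hdW S ((Λ (Matrix.GeneralLinearGroup.map (algebraMap L (AdeleRing (𝓞 L) L)) (γ (Projectivization.mk L w hw))))⁻¹ * (((z : unipDelta L e dV hdV dW hdW) : HA L e dV hdV dW hdW) * n₂ t) * (Λ (Matrix.GeneralLinearGroup.map (algebraMap L (AdeleRing (𝓞 L) L)) (γ (Projectivization.mk L w hw))))) : ℂ) =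
      conj (unipDeltaChar L e dV hdV dW hdW S ((Λ (Matrix.GeneralLinearGroup.map (algebraMap L (AdeleRing (𝓞 L) L)) (γ (Projectivization.mk L w hw))))⁻¹ * n₂ t * (Λ (Matrix.GeneralLinearGroup.map (algebraMap L (AdeleRing (𝓞 L) L)) (γ (Projectivization.mk L w hw))))) : ℂ) :=
    conj_unipDeltaChar_conj_invariant hg₀ hpP S hcorner hz ((hZlaw (z : unipDelta L e dV hdV dW hdW)).1 z.2) (hn₂mem t)
  show conj (unipDeltaChar L e dV hdV dW hdW S ((Λ (Matrix.GeneralLinearGroup.map (algebraMap L (AdeleRing (𝓞 L) L)) (γ (Projectivization.mk L w hw))))⁻¹ * (n₂ t * ((z : unipDelta L e dV hdV dW hdW) : HA L e dV hdV dW hdW)) * (Λ (Matrix.GeneralLinearGroup.map (algebraMap L (AdeleRing (𝓞 L) L)) (γ (Projectivization.mk L w hw))))) : ℂ) *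
      f (weylDelta L e dV hdV dW hdW * (n₂ t * ((z : unipDelta L e dV hdV dW hdW) : HA L e dV hdV dW hdW)) * ((Λ (Matrix.GeneralLinearGroup.map (algebraMap L (AdeleRing (𝓞 L) L)) (γ (Projectivization.mk L w hw)))) * h)) =
    conj (unipDeltaChar L e dV hdV dW hdW S ((Λ (Matrix.GeneralLinearGroup.map (algebraMap L (AdeleRing (𝓞 L) L)) (γ (Projectivization.mk L w hw))))⁻¹ * n₂ t * (Λ (Matrix.GeneralLinearGroup.map (algebraMap L (AdeleRing (𝓞 L) L)) (γ (Projectivization.mk L w hw))))) : ℂ) *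
      f (weylDelta L e dV hdV dW hdW * ((z : unipDelta L e dV hdV dW hdW) : HA L e dV hdV dW hdW) * (n₂ t * ((Λ (Matrix.GeneralLinearGroup.map (algebraMap L (AdeleRing (𝓞 L) L)) (γ (Projectivization.mk L w hw)))) * h)))
  rw [mul_comm_of_mem_unipDelta L e dV hdV dW hdW (hn₂mem t) hz, hψz, mul_assoc (weylDelta L e dV hdV dW hdW) _ ((Λ (Matrix.GeneralLinearGroup.map (algebraMap L (AdeleRing (𝓞 L) L)) (γ (Projectivization.mk L w hw)))) * h),
    mul_assoc ((z : unipDelta L e dV hdV dW hdW) : HA L e dV hdV dW hdW) (n₂ t) ((Λ (Matrix.GeneralLinearGroup.map (algebraMap L (AdeleRing (𝓞 L) L)) (γ (Projectivization.mk L w hw)))) * h), ← mul_assoc (weylDelta L e dV hdV dW hdW)]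

end Two

end Summit.HodgeConjecture.HodgeConjecture.Cruxes.HLiu418.K2LiuRankOneBigCellCornerFrame

end
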